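import Mathlib.MeasureTheory.Measure.Lebesgue.VolumeOfBalls
import Literature.Geometry.Lorentzian.VolumeSmallBalls
import Literature.Geometry.Lorentzian.InitialData
import Literature.Geometry.Riemannian.RiemannianDistance
import HarnessLib

/-!
# Geodesic balls and the volume radius of a Riemannian manifold / of an initial data set
(topic `Geometry/Lorentzian`; definition item `defn-volumeRadius`, wanted by route
`FinalStateConjecture/SuperenergyCensus`, crux `EpsilonRegularityNoStrongTrapping`)

Klainerman–Rodnianski–Szeftel, *The bounded `L²` curvature conjecture*, Invent. Math. 202
(2015) = arXiv:1204.1767, §2.2, Def. 2.1: "Let `B_r(p)` denote the geodesic ball of center `p`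
and radius `r`. The volume radius `r_vol(p, r)` at a point `p ∈ M` and scales `≤ r` is defined
by `r_vol(p, r) = inf_{r' ≤ r} |B_{r'}(p)| / r'³`, with `|B_r|` the volume of `B_r` relative to
the metric on `M`. The volume radius `r_vol(M, r)` of `M` on scales `≤ r` is the infimum of
`r_vol(p, r)` over all points `p ∈ M`." It is the non-collapsing hypothesis of the bounded `L²`
curvature theorem (Thm. 2.2: `Ric ∈ L²(Σ₀)`, `∇k ∈ L²(Σ₀)`, `r_vol(Σ₀, 1) > 0`). (The arXiv
source prints the denominator as `r³`; with that reading the infimum over `r' ≤ r` vanishes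
identically and the hypothesis `r_vol(Σ₀, 1) > 0` — and the bound `r_vol(Σ_t, 1) ≥ 1/4` proved
in the overview arXiv:1204.1772, Ch. 4, §2.2 — would be void; the scale-invariant quotient
`|B_{r'}(p)| / r'³` is meant, as in every use of the notion, and is what is formalised.)

Over the vocabulary of `Volume.lean` / `VolumeSmallBalls.lean` (the Riemannian measure
`riemannianMeasure h` of a `C^n` Riemannian metric `h` on `TN`; Mathlib's length distance
`riemannianEDist` for the Riemannian bundle structure of `h`) we define, for a manifold `N` of
dimension `m = dim E` and a `ContMDiffRiemannianMetric` `h`: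

* `geodesicEDist h x y` — the Riemannian (length) distance `d_h(x, y) ∈ [0, ∞]`
  (O'Neill 1983, Ch. 5, Def. 15), Mathlib's `riemannianEDist` for `|v| = h(v,v)^{1/2}`;
  *definitionally* the distance `PseudoRiemannianMetric.edist` of `RiemannianDistance.lean` of
  `PseudoRiemannianMetric.ofRiemannian h` (`geodesicEDist_eq_edist_ofRiemannian`,
  `geodesicEDist_toContMDiffRiemannianMetric`), so that file's API (continuity, neighbourhood
  bases, definiteness) applies verbatim;
* `geodesicBall h x r = {y | d_h(x, y) < r}` — the geodesic (= metric) ball, `r ∈ [0, ∞]` (the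
  sets `{y | riemannianEDist p y < r}` of `VolumeSmallBalls.lean`, `geodesicBall_eq_setOf`);
  open, a neighbourhood basis, measurable;
* `volumeRadiusAt h x r = r_vol(x, r) = ⨅_{0 < r' ≤ r} Vol_h(B_{r'}(x)) / r'ᵐ` and
  `volumeRadius h r = r_vol(N, r) = ⨅_x r_vol(x, r)` (KRS Def. 2.1 in dimension `m`; printed
  for `m = 3`), valued in `ℝ≥0∞`;
* `InitialDataSet.volumeRadius D r = volumeRadius D.h r` for an initial data set `D = (h, k)`
  (`InitialData.lean`); for `3`-dimensional data this is `⨅_x ⨅_{0<r'≤r} |B_{r'}(x)|_h / r'³`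
  (`InitialDataSet.volumeRadius_eq`). No connection is involved (the distance is the length
  metric), so no `[D.metric.HasLeviCivita]` hypothesis is taken.

API: characterisations (`le_volumeRadius_iff`, `volumeRadius_le_div`,
`mul_le_measure_geodesicBall_of_le_volumeRadius`: "`c ≤ r_vol(N, r)` means
`c · r'ᵐ ≤ Vol_h B_{r'}(x)` for all `x` and `0 < r' ≤ r`", the form in which the hypothesis is
consumed), **monotonicity in the scale** (`volumeRadius_anti`), the junk value `⊤` for `r ≤ 0`
(empty infimum), **positivity on closed manifolds** (`volumeRadius_pos_of_compactSpace`, from the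
lower volume bound for small balls of `VolumeSmallBalls.lean`), and the **Euclidean sanity
check**: for an inner product space `F` with its flat metric `riemannianMetricVectorSpace F`
(Mathlib) the distance is the norm distance, geodesic balls are norm balls, the Riemannian
measure is Lebesgue measure (`riemannianMeasure_riemannianMetricVectorSpace`), hence
`r_vol(F, r) = Vol(B₁(0))` for `r > 0` and `r_vol(ℝ³, r) = 4π/3`
(`volumeRadius_euclideanSpace_fin_three`). (The tree's `trivialData` live on the open
submanifold `⊤ ⊆ E3`; the transfer along that open embedding is not carried out here.)

## Design notes

* Light imports on purpose: the total forms `PseudoRiemannianMetric.ball / .vol` of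
  `Riemannian/CanonicalNeighbourhoods.lean` carry the Ricci-flow-with-surgery cone, whereas the
  GR files (`AFSobolev`, `EndVolume`, …) use `riemannianMeasure D.h` of `Volume.lean`, the
  measure used here; the distance is bridged to `RiemannianDistance.lean` by `rfl` lemmas.
* Ball radii are extended reals (as for `PseudoRiemannianMetric.ball`); the scales `r, r'` are
  real, as printed, the quotient being `Vol / ENNReal.ofReal (r' ^ dim E)`.
* `euclideanHausdorffMeasure_eq_of_edist_eq`: two emetric structures with the same distance
  function have the same Euclidean Hausdorff measures — the transport lemma behind the sanity
  check (length-metric emetric structure of `Volume.lean` on `F` versus the norm structure).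

## References

* [KlainermanRodnianskiSzeftel2015] S. Klainerman, I. Rodnianski, J. Szeftel, *The bounded
  `L²` curvature conjecture*, Invent. Math. 202 (2015) 91–216 = arXiv:1204.1767, §2.2,
  Def. 2.1, Thm. 2.2.
* [ONeill1983] B. O'Neill, *Semi-Riemannian geometry*, Academic Press 1983, Ch. 5, Def. 15,
  Prop. 18 (Riemannian distance, `ε`-neighbourhoods).
* [Chavel2006] I. Chavel, *Riemannian Geometry: A Modern Introduction*, 2nd ed., CUP 2006,
  §III.3 (volume `V(x; r)` of metric disks).
-/

noncomputable section

open Manifold Bundle MeasureTheory Measure Set Filter Metric Module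
open scoped ContDiff Topology ENNReal NNReal

namespace Literature.Geometry.Lorentzian

/-! ### A transport lemma for Hausdorff measures -/

/-- **Two extended metric structures with the same distance function have the same
Euclidean-normalised Hausdorff measures** (they are even equal as structures: the uniformity of
an emetric space is determined by its distance, `PseudoEMetricSpace.ext`). [folklore] -/
theorem euclideanHausdorffMeasure_eq_of_edist_eq {α : Type*} [MeasurableSpace α]
    (m₁ m₂ : EMetricSpace α) (b₁ : letI := m₁; BorelSpace α) (b₂ : letI := m₂; BorelSpace α)
    (hd : ∀ x y : α, (letI := m₁; edist x y) = (letI := m₂; edist x y)) (d : ℕ) :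
    @euclideanHausdorffMeasure α m₁ _ b₁ d = @euclideanHausdorffMeasure α m₂ _ b₂ d := by
  obtain rfl : m₁ = m₂ := by
    refine EMetricSpace.ext ?_
    have key : ∀ e₁ e₂ : EDist α, (∀ x y, @edist α e₁ x y = @edist α e₂ x y) → e₁ = e₂ := by
      rintro ⟨f⟩ ⟨g⟩ hfg
      congr
      funext x y
      exact hfg x y
    exact key _ _ hd
  rfl

/-! ### Geodesic distance and geodesic balls of a `ContMDiffRiemannianMetric` -/

section Metric

variable {E : Type*} [NormedAddCommGroup E] [NormedSpace ℝ E]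
  {H : Type*} [TopologicalSpace H] {I : ModelWithCorners ℝ E H} {n : ℕ∞ω}
  {N : Type*} [TopologicalSpace N] [ChartedSpace H N] [IsManifold I 1 N]

/-- The **Riemannian (geodesic) distance** `d_h(x, y) ∈ [0, ∞]` of the `C^n` Riemannian metric
`h` on `TN`: the infimum of the `h`-lengths `∫ h(γ', γ')^{1/2}` of the `C¹` paths from `x` to `y`
(O'Neill 1983, Ch. 5, Def. 15; KRS 2015, §2.2), i.e. Mathlib's `riemannianEDist` for the
Riemannian bundle structure `⟨h.toRiemannianMetric⟩` of `h` — the distance whose Hausdorff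
measure is `riemannianMeasure h` (`Volume.lean`). [cite: ONeill1983, Ch. 5, Def. 15 (p. 134)] -/
def geodesicEDist (h : ContMDiffRiemannianMetric I n E (TangentSpace I : N → Type _)) (x y : N) :
    ℝ≥0∞ :=
  letI : RiemannianBundle (fun x : N ↦ TangentSpace I x) :=
    ⟨h.toContinuousRiemannianMetric.toRiemannianMetric⟩
  riemannianEDist I x y

/-- The **geodesic ball** `B_r(x) = {y | d_h(x, y) < r}` of the Riemannian metric `h`, radius
`r ∈ [0, ∞]` (O'Neill 1983, Ch. 5, Def. 15 ff., the `ε`-neighbourhood; KRS 2015, Def. 2.1,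
"`B_r(p)` the geodesic ball of center `p` and radius `r`").
[cite: KlainermanRodnianskiSzeftel2015, Def. 2.1] -/
def geodesicBall (h : ContMDiffRiemannianMetric I n E (TangentSpace I : N → Type _)) (x : N)
    (r : ℝ≥0∞) : Set N :=
  {y | geodesicEDist h x y < r}

variable (h : ContMDiffRiemannianMetric I n E (TangentSpace I : N → Type _))

/-- `d_h(x, x) = 0`. [folklore] -/
@[simp] theorem geodesicEDist_self (x : N) : geodesicEDist h x x = 0 := by
  letI : RiemannianBundle (fun x : N ↦ TangentSpace I x) :=
    ⟨h.toContinuousRiemannianMetric.toRiemannianMetric⟩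
  exact riemannianEDist_self

/-- Symmetry `d_h(x, y) = d_h(y, x)`. [folklore] -/
theorem geodesicEDist_comm (x y : N) : geodesicEDist h x y = geodesicEDist h y x := by
  letI : RiemannianBundle (fun x : N ↦ TangentSpace I x) :=
    ⟨h.toContinuousRiemannianMetric.toRiemannianMetric⟩
  exact riemannianEDist_comm

/-- Triangle inequality `d_h(x, z) ≤ d_h(x, y) + d_h(y, z)`. [folklore] -/
theorem geodesicEDist_triangle (x y z : N) :
    geodesicEDist h x z ≤ geodesicEDist h x y + geodesicEDist h y z := by
  letI : RiemannianBundle (fun x : N ↦ TangentSpace I x) :=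
    ⟨h.toContinuousRiemannianMetric.toRiemannianMetric⟩
  exact riemannianEDist_triangle

/-- **Bridge to `RiemannianDistance.lean`**: the geodesic distance of `h` is, by definition, the
Riemannian distance `PseudoRiemannianMetric.edist` of the (Riemannian) pseudo-Riemannian metric
`ofRiemannian h` associated with `h`. [folklore] -/
theorem geodesicEDist_eq_edist_ofRiemannian [IsManifold I ∞ N] [FiniteDimensional ℝ E]
    (x y : N) :
    geodesicEDist h x y = (PseudoRiemannianMetric.ofRiemannian h).edist
      (PseudoRiemannianMetric.isRiemannian_ofRiemannian h) x y := rfl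

omit h in
/-- **Bridge to `RiemannianDistance.lean`**, converse direction: for a Riemannian
`PseudoRiemannianMetric g`, the geodesic distance of the Mathlib metric
`g.toContMDiffRiemannianMetric hg` is `g.edist hg`. [folklore] -/
theorem geodesicEDist_toContMDiffRiemannianMetric [IsManifold I ∞ N] [FiniteDimensional ℝ E]
    (g : PseudoRiemannianMetric I n E (TangentSpace I : N → Type _)) (hg : g.IsRiemannian)
    (x y : N) : geodesicEDist (g.toContMDiffRiemannianMetric hg) x y = g.edist hg x y := rfl

/-- Membership in a geodesic ball: `y ∈ B_r(x) ↔ d_h(x, y) < r`. [folklore] -/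
@[simp] theorem mem_geodesicBall {x y : N} {r : ℝ≥0∞} :
    y ∈ geodesicBall h x r ↔ geodesicEDist h x y < r := Iff.rfl

/-- The geodesic ball is the set `{y | riemannianEDist x y < r}` of `VolumeSmallBalls.lean`
(same Riemannian bundle structure), definitionally. [folklore] -/
theorem geodesicBall_eq_setOf (x : N) (r : ℝ≥0∞) :
    geodesicBall h x r = {y | (letI : RiemannianBundle (fun x : N ↦ TangentSpace I x) :=
      ⟨h.toContinuousRiemannianMetric.toRiemannianMetric⟩; riemannianEDist I x y) < r} := rfl

/-- The centre lies in every geodesic ball of positive radius. [folklore] -/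
theorem mem_geodesicBall_self (x : N) {r : ℝ≥0∞} (hr : 0 < r) : x ∈ geodesicBall h x r := by
  rw [mem_geodesicBall, geodesicEDist_self]; exact hr

/-- Geodesic balls are monotone in the radius. [folklore] -/
theorem geodesicBall_mono (x : N) {r r' : ℝ≥0∞} (hrr' : r ≤ r') :
    geodesicBall h x r ⊆ geodesicBall h x r' := fun _ hy ↦ lt_of_lt_of_le hy hrr'

/-- A geodesic ball of radius `0` is empty. [folklore] -/
@[simp] theorem geodesicBall_zero (x : N) : geodesicBall h x 0 = ∅ := by
  ext y; simp

/-- **Geodesic balls form a neighbourhood basis** (O'Neill 1983, Ch. 5, Prop. 18: the distance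
is compatible with the manifold topology; Mathlib: the topology of
`PseudoEMetricSpace.ofRiemannianMetric` is the manifold topology, Gouëzel), on regular `C¹`
manifolds. [cite: ONeill1983, Ch. 5, Prop. 18 (pp. 135–136)] -/
theorem nhds_basis_geodesicBall [RegularSpace N] (x : N) :
    (𝓝 x).HasBasis (fun r : ℝ≥0∞ ↦ 0 < r) (geodesicBall h x) := by
  letI : RiemannianBundle (fun x : N ↦ TangentSpace I x) :=
    ⟨h.toContinuousRiemannianMetric.toRiemannianMetric⟩
  letI : PseudoEMetricSpace N := .ofRiemannianMetric I N
  have heq : geodesicBall h x = Metric.eball x := funext fun r ↦ by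
    ext y; rw [Metric.mem_eball']; rfl
  rw [heq]
  exact Metric.nhds_basis_eball

/-- **Geodesic balls are open** (O'Neill 1983, Ch. 5, Prop. 18), on regular `C¹` manifolds.
[cite: ONeill1983, Ch. 5, Prop. 18 (pp. 135–136)] -/
theorem isOpen_geodesicBall [RegularSpace N] (x : N) (r : ℝ≥0∞) :
    IsOpen (geodesicBall h x r) := by
  letI : RiemannianBundle (fun x : N ↦ TangentSpace I x) :=
    ⟨h.toContinuousRiemannianMetric.toRiemannianMetric⟩
  letI : PseudoEMetricSpace N := .ofRiemannianMetric I N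
  have heq : geodesicBall h x r = Metric.eball x r := by
    ext y; rw [Metric.mem_eball']; rfl
  rw [heq]
  exact Metric.isOpen_eball

/-- A geodesic ball of positive radius is a neighbourhood of its centre. [folklore] -/
theorem geodesicBall_mem_nhds [RegularSpace N] (x : N) {r : ℝ≥0∞} (hr : 0 < r) :
    geodesicBall h x r ∈ 𝓝 x :=
  (isOpen_geodesicBall h x r).mem_nhds (mem_geodesicBall_self h x hr)

/-- Geodesic balls are measurable (they are open), on regular `C¹` manifolds with their Borel
structure. [folklore] -/
theorem measurableSet_geodesicBall [RegularSpace N] [MeasurableSpace N] [BorelSpace N] (x : N)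
    (r : ℝ≥0∞) : MeasurableSet (geodesicBall h x r) :=
  (isOpen_geodesicBall h x r).measurableSet

end Metric

/-! ### The volume radius (Klainerman–Rodnianski–Szeftel 2015, Def. 2.1) -/

section VolumeRadius

variable {E : Type*} [NormedAddCommGroup E] [NormedSpace ℝ E]
  {H : Type*} [TopologicalSpace H] {I : ModelWithCorners ℝ E H} {n : ℕ∞ω}
  {N : Type*} [TopologicalSpace N] [ChartedSpace H N] [IsManifold I 1 N] [T3Space N]
  [MeasurableSpace N] [BorelSpace N]

/-- The **volume radius of `(N, h)` at the point `x` on scales `≤ r`**: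
`r_vol(x, r) = inf_{0 < r' ≤ r} Vol_h(B_{r'}(x)) / r'ᵐ`, `m = dim N = dim E`, where `B_{r'}(x)`
is the geodesic ball and `Vol_h = riemannianMeasure h` the Riemannian measure
(Klainerman–Rodnianski–Szeftel 2015, Def. 2.1, there for `m = 3`:
"`r_vol(p, r) = inf_{r' ≤ r} |B_{r'}(p)| / r'³` with `|B_r|` the volume of `B_r` relative to the
metric on `M`"; the arXiv text misprints the denominator as `r³`). An extended nonnegative
real; for `r ≤ 0` the infimum is empty and the value is the junk value `⊤`
(`volumeRadiusAt_of_nonpos`). [cite: KlainermanRodnianskiSzeftel2015, Def. 2.1] -/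
def volumeRadiusAt (h : ContMDiffRiemannianMetric I n E (TangentSpace I : N → Type _)) (x : N)
    (r : ℝ) : ℝ≥0∞ :=
  ⨅ r' ∈ Ioc 0 r, riemannianMeasure h (geodesicBall h x (ENNReal.ofReal r')) /
    ENNReal.ofReal (r' ^ finrank ℝ E)

/-- The **volume radius of `(N, h)` on scales `≤ r`**: `r_vol(N, r) = inf_x r_vol(x, r)`, the
infimum over all points of the volume radius at `x` (Klainerman–Rodnianski–Szeftel 2015,
Def. 2.1: "The volume radius `r_vol(M, r)` of `M` on scales `≤ r` is the infimum of
`r_vol(p, r)` over all points `p ∈ M`"; hypothesis `r_vol(Σ₀, 1) > 0` of their Thm. 2.2). Junk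
value `⊤` for `r ≤ 0`. [cite: KlainermanRodnianskiSzeftel2015, Def. 2.1] -/
def volumeRadius (h : ContMDiffRiemannianMetric I n E (TangentSpace I : N → Type _)) (r : ℝ) :
    ℝ≥0∞ :=
  ⨅ x, volumeRadiusAt h x r

variable (h : ContMDiffRiemannianMetric I n E (TangentSpace I : N → Type _))

/-- Unfolding of `volumeRadiusAt`. [folklore] -/
theorem volumeRadiusAt_eq (x : N) (r : ℝ) :
    volumeRadiusAt h x r =
      ⨅ r' ∈ Ioc 0 r, riemannianMeasure h (geodesicBall h x (ENNReal.ofReal r')) /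
        ENNReal.ofReal (r' ^ finrank ℝ E) := rfl

/-- Unfolding of `volumeRadius`: `r_vol(N, r) = ⨅_x ⨅_{0 < r' ≤ r} Vol_h(B_{r'}(x)) / r'ᵐ`.
[folklore] -/
theorem volumeRadius_eq (r : ℝ) :
    volumeRadius h r =
      ⨅ x, ⨅ r' ∈ Ioc 0 r, riemannianMeasure h (geodesicBall h x (ENNReal.ofReal r')) /
        ENNReal.ofReal (r' ^ finrank ℝ E) := rfl

/-- `r_vol(N, r) ≤ r_vol(x, r)`. [folklore] -/
theorem volumeRadius_le_volumeRadiusAt (x : N) (r : ℝ) :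
    volumeRadius h r ≤ volumeRadiusAt h x r :=
  iInf_le _ x

/-- `r_vol(x, r) ≤ Vol_h(B_{r'}(x)) / r'ᵐ` for every scale `0 < r' ≤ r`. [folklore] -/
theorem volumeRadiusAt_le_div (x : N) {r r' : ℝ} (hr' : 0 < r') (hr'r : r' ≤ r) :
    volumeRadiusAt h x r ≤ riemannianMeasure h (geodesicBall h x (ENNReal.ofReal r')) /
      ENNReal.ofReal (r' ^ finrank ℝ E) :=
  biInf_le _ (show r' ∈ Ioc 0 r from ⟨hr', hr'r⟩)

/-- `r_vol(N, r) ≤ Vol_h(B_{r'}(x)) / r'ᵐ` for every point `x` and scale `0 < r' ≤ r`.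
[folklore] -/
theorem volumeRadius_le_div (x : N) {r r' : ℝ} (hr' : 0 < r') (hr'r : r' ≤ r) :
    volumeRadius h r ≤ riemannianMeasure h (geodesicBall h x (ENNReal.ofReal r')) /
      ENNReal.ofReal (r' ^ finrank ℝ E) :=
  (volumeRadius_le_volumeRadiusAt h x r).trans (volumeRadiusAt_le_div h x hr' hr'r)

/-- Characterisation of lower bounds for `r_vol(x, r)`. [folklore] -/
theorem le_volumeRadiusAt_iff {c : ℝ≥0∞} {x : N} {r : ℝ} :
    c ≤ volumeRadiusAt h x r ↔ ∀ r' : ℝ, 0 < r' → r' ≤ r →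
      c ≤ riemannianMeasure h (geodesicBall h x (ENNReal.ofReal r')) /
        ENNReal.ofReal (r' ^ finrank ℝ E) := by
  simp only [volumeRadiusAt, le_iInf_iff, mem_Ioc, and_imp]

/-- Characterisation of lower bounds for `r_vol(N, r)`: `c ≤ r_vol(N, r)` iff
`c ≤ Vol_h(B_{r'}(x)) / r'ᵐ` for all `x` and all `0 < r' ≤ r`. [folklore] -/
theorem le_volumeRadius_iff {c : ℝ≥0∞} {r : ℝ} :
    c ≤ volumeRadius h r ↔ ∀ (x : N) (r' : ℝ), 0 < r' → r' ≤ r →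
      c ≤ riemannianMeasure h (geodesicBall h x (ENNReal.ofReal r')) /
        ENNReal.ofReal (r' ^ finrank ℝ E) := by
  simp only [volumeRadius, le_iInf_iff, le_volumeRadiusAt_iff]

/-- **The non-collapsing form of a lower bound on the volume radius**: if `c ≤ r_vol(N, r)`
then `c · r'ᵐ ≤ Vol_h(B_{r'}(x))` for every point `x` and every scale `0 < r' ≤ r` (the way the
hypothesis `r_vol(Σ₀, 1) ≥ 1/2` of KRS 2015, Thm. 2.10 is used).
[cite: KlainermanRodnianskiSzeftel2015, Def. 2.1] -/
theorem mul_le_measure_geodesicBall_of_le_volumeRadius {c : ℝ≥0∞} {r : ℝ}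
    (hc : c ≤ volumeRadius h r) (x : N) {r' : ℝ} (hr' : 0 < r') (hr'r : r' ≤ r) :
    c * ENNReal.ofReal (r' ^ finrank ℝ E) ≤
      riemannianMeasure h (geodesicBall h x (ENNReal.ofReal r')) := by
  have hb : ENNReal.ofReal (r' ^ finrank ℝ E) ≠ 0 :=
    (ENNReal.ofReal_pos.2 (pow_pos hr' _)).ne'
  exact (ENNReal.le_div_iff_mul_le (Or.inl hb) (Or.inl ENNReal.ofReal_ne_top)).1
    ((le_volumeRadius_iff h).1 hc x r' hr' hr'r)

/-- Conversely, uniform lower volume bounds `c · r'ᵐ ≤ Vol_h(B_{r'}(x))` for all `x` and all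
`0 < r' ≤ r` give `c ≤ r_vol(N, r)`. [folklore] -/
theorem le_volumeRadius_of_forall_mul_le {c : ℝ≥0∞} {r : ℝ}
    (hc : ∀ (x : N) (r' : ℝ), 0 < r' → r' ≤ r → c * ENNReal.ofReal (r' ^ finrank ℝ E) ≤
      riemannianMeasure h (geodesicBall h x (ENNReal.ofReal r'))) :
    c ≤ volumeRadius h r := by
  refine (le_volumeRadius_iff h).2 fun x r' hr' hr'r ↦ ?_
  have hb : ENNReal.ofReal (r' ^ finrank ℝ E) ≠ 0 :=
    (ENNReal.ofReal_pos.2 (pow_pos hr' _)).ne'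
  exact (ENNReal.le_div_iff_mul_le (Or.inl hb) (Or.inl ENNReal.ofReal_ne_top)).2
    (hc x r' hr' hr'r)

/-- **The volume radius at a point is antitone in the scale**:
`r₁ ≤ r₂ → r_vol(x, r₂) ≤ r_vol(x, r₁)` (an infimum over more scales). [folklore] -/
theorem volumeRadiusAt_anti (x : N) : Antitone (volumeRadiusAt h x) :=
  fun _ _ h₁₂ ↦ biInf_mono fun _ hr' ↦ ⟨hr'.1, hr'.2.trans h₁₂⟩

/-- **The volume radius is antitone in the scale**: `r₁ ≤ r₂ → r_vol(N, r₂) ≤ r_vol(N, r₁)`.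
[folklore] -/
theorem volumeRadius_anti : Antitone (volumeRadius h) :=
  fun _ _ h₁₂ ↦ iInf_mono fun x ↦ volumeRadiusAt_anti h x h₁₂

/-- Junk value: for `r ≤ 0` there are no scales `0 < r' ≤ r` and `r_vol(x, r) = ⊤`.
[folklore] -/
theorem volumeRadiusAt_of_nonpos (x : N) {r : ℝ} (hr : r ≤ 0) : volumeRadiusAt h x r = ⊤ := by
  rw [volumeRadiusAt, Ioc_eq_empty (not_lt.2 hr)]
  exact iInf_emptyset

/-- Junk value: for `r ≤ 0`, `r_vol(N, r) = ⊤`. [folklore] -/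
theorem volumeRadius_of_nonpos {r : ℝ} (hr : r ≤ 0) : volumeRadius h r = ⊤ := by
  simp [volumeRadius, volumeRadiusAt_of_nonpos h _ hr]

/-- **Closed manifolds have positive volume radius on every scale**: for a `C^k` Riemannian
metric `h` on a compact boundaryless manifold `N` of dimension `m = dim E`, `0 < r_vol(N, r)`
for every `r` — by the uniform Euclidean lower bound `c · r'ᵐ ≤ Vol_h(B_{r'}(x))`, `0 < r' ≤ r`,
for small geodesic balls on a compact manifold
(`exists_mul_pow_le_riemannianVolume_of_compactSpace`, `VolumeSmallBalls.lean`; Chavel 2006,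
§III.3). [folklore] -/
theorem volumeRadius_pos_of_compactSpace [I.Boundaryless] [FiniteDimensional ℝ E]
    [CompactSpace N] (r : ℝ) : 0 < volumeRadius h r := by
  obtain ⟨c, hc, hle⟩ := exists_mul_pow_le_riemannianVolume_of_compactSpace (I := I) h r
  have hcr : ENNReal.ofReal c ≤ volumeRadius h r := by
    refine le_volumeRadius_of_forall_mul_le h fun x r' hr' hr'r ↦ ?_
    rw [← ENNReal.ofReal_mul hc.le]
    exact hle x r' hr' hr'r
  exact lt_of_lt_of_le (ENNReal.ofReal_pos.2 hc) hcr

end VolumeRadius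

/-! ### Euclidean sanity check: inner product spaces -/

section VectorSpace

variable {F : Type*} [NormedAddCommGroup F] [InnerProductSpace ℝ F]

/-- On an inner product space with its flat Riemannian metric (Mathlib's
`riemannianMetricVectorSpace`) the geodesic distance is the norm distance (Mathlib's
`IsRiemannianManifold 𝓘(ℝ, F) F` instance: straight segments are shortest). [folklore] -/
theorem geodesicEDist_riemannianMetricVectorSpace (x y : F) :
    geodesicEDist (riemannianMetricVectorSpace F) x y = edist x y :=
  (IsRiemannianManifold.out (I := 𝓘(ℝ, F)) x y).symm

/-- On an inner product space the geodesic balls of the flat metric are the metric balls.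
[folklore] -/
theorem geodesicBall_riemannianMetricVectorSpace_eq_eball (x : F) (r : ℝ≥0∞) :
    geodesicBall (riemannianMetricVectorSpace F) x r = Metric.eball x r := by
  ext y
  rw [mem_geodesicBall, geodesicEDist_riemannianMetricVectorSpace, Metric.mem_eball']

/-- On an inner product space the geodesic ball of real radius `r` of the flat metric is the
norm ball `ball x r`. [folklore] -/
theorem geodesicBall_riemannianMetricVectorSpace (x : F) (r : ℝ) :
    geodesicBall (riemannianMetricVectorSpace F) x (ENNReal.ofReal r) = ball x r := by
  ext y
  rw [mem_geodesicBall, geodesicEDist_riemannianMetricVectorSpace, Metric.mem_ball',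
    edist_lt_ofReal]

/-- On an inner product space the Riemannian volume in dimension `d` of the flat metric is the
Euclidean Hausdorff measure `μHE[d]` of the norm distance (the two emetric structures have the
same distance, `euclideanHausdorffMeasure_eq_of_edist_eq`). [folklore] -/
theorem riemannianVolume_riemannianMetricVectorSpace [MeasurableSpace F] [BorelSpace F]
    (d : ℕ) : riemannianVolume (riemannianMetricVectorSpace F) d = (μHE[d] : Measure F) := by
  unfold riemannianVolume
  exact euclideanHausdorffMeasure_eq_of_edist_eq _ _ _ _
    (fun x y ↦ (IsRiemannianManifold.out (I := 𝓘(ℝ, F)) x y).symm) d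

/-- **On an inner product space the Riemannian measure of the flat metric is Lebesgue measure**
(`μHE[dim F] = volume`, Mathlib's `InnerProductSpace.euclideanHausdorffMeasure_eq_volume`).
[folklore] -/
theorem riemannianMeasure_riemannianMetricVectorSpace [FiniteDimensional ℝ F]
    [MeasurableSpace F] [BorelSpace F] :
    riemannianMeasure (riemannianMetricVectorSpace F) = (volume : Measure F) := by
  rw [riemannianMeasure, riemannianVolume_riemannianMetricVectorSpace,
    InnerProductSpace.euclideanHausdorffMeasure_eq_volume]

/-- **Euclidean volume radius at a point**: for the flat metric of an inner product space `F`
of dimension `m`, `r_vol(x, r) = Vol(B₁(0))` for every `x` and every `r > 0`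
(`Vol(B_{r'}(x)) = r'ᵐ Vol(B₁(0))`). [folklore] -/
theorem volumeRadiusAt_riemannianMetricVectorSpace [FiniteDimensional ℝ F] [MeasurableSpace F]
    [BorelSpace F] (x : F) {r : ℝ} (hr : 0 < r) :
    volumeRadiusAt (riemannianMetricVectorSpace F) x r = volume (ball (0 : F) 1) := by
  have hquot : ∀ r' : ℝ, 0 < r' →
      volume (ball x r') / ENNReal.ofReal (r' ^ finrank ℝ F) = volume (ball (0 : F) 1) := by
    intro r' hr'
    rw [Measure.addHaar_ball_of_pos volume x hr', mul_comm, ENNReal.mul_div_cancel_right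
      (ENNReal.ofReal_pos.2 (pow_pos hr' _)).ne' ENNReal.ofReal_ne_top]
  simp only [volumeRadiusAt, geodesicBall_riemannianMetricVectorSpace,
    riemannianMeasure_riemannianMetricVectorSpace]
  apply le_antisymm
  · exact (biInf_le _ (show r ∈ Ioc 0 r from ⟨hr, le_rfl⟩)).trans_eq (hquot r hr)
  · exact le_iInf₂ fun r' hr' ↦ (hquot r' hr'.1).ge

/-- **Euclidean volume radius**: for the flat metric of an inner product space `F`,
`r_vol(F, r) = Vol(B₁(0))` for every `r > 0`. [folklore] -/
theorem volumeRadius_riemannianMetricVectorSpace [FiniteDimensional ℝ F] [MeasurableSpace F]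
    [BorelSpace F] {r : ℝ} (hr : 0 < r) :
    volumeRadius (riemannianMetricVectorSpace F) r = volume (ball (0 : F) 1) := by
  simp only [volumeRadius, volumeRadiusAt_riemannianMetricVectorSpace _ hr, iInf_const]

/-- **Sanity check (KRS normalisation)**: Euclidean `3`-space has volume radius
`r_vol(ℝ³, r) = |B₁| = 4π/3` on every scale `r > 0`. [folklore] -/
theorem volumeRadius_euclideanSpace_fin_three {r : ℝ} (hr : 0 < r) :
    volumeRadius (riemannianMetricVectorSpace (EuclideanSpace ℝ (Fin 3))) r =
      ENNReal.ofReal (4 * Real.pi / 3) := by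
  rw [volumeRadius_riemannianMetricVectorSpace hr, EuclideanSpace.volume_ball_fin_three,
    ENNReal.ofReal_one, one_pow, one_mul]
  congr 1
  ring

end VectorSpace

/-! ### The volume radius of an initial data set -/

namespace InitialDataSet

variable {E : Type*} [NormedAddCommGroup E] [NormedSpace ℝ E] {H : Type*} [TopologicalSpace H]
  {I : ModelWithCorners ℝ E H} {X : Type*} [TopologicalSpace X] [ChartedSpace H X]
  [IsManifold I ∞ X] [T3Space X] [MeasurableSpace X] [BorelSpace X]

/-- The **volume radius on scales `≤ r` of an initial data set** `D = (X, h, k)`: the volume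
radius `r_vol(X, r) = inf_x inf_{0 < r' ≤ r} Vol_h(B_{r'}(x)) / r'^{dim X}` of its Riemannian
manifold `(X, h)` (`Literature.Geometry.Lorentzian.volumeRadius D.h r`;
Klainerman–Rodnianski–Szeftel 2015, Def. 2.1 and Thm. 2.2, hypothesis `r_vol(Σ₀, 1) > 0` on the
initial slice). For `3`-dimensional data the exponent is `3` (`volumeRadius_eq`).
[cite: KlainermanRodnianskiSzeftel2015, Def. 2.1] -/
abbrev volumeRadius (D : InitialDataSet I X) (r : ℝ) : ℝ≥0∞ :=
  Literature.Geometry.Lorentzian.volumeRadius D.h r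

/-- Unfolding: `D.volumeRadius r = volumeRadius D.h r`. [folklore] -/
theorem volumeRadius_def (D : InitialDataSet I X) (r : ℝ) :
    D.volumeRadius r = Literature.Geometry.Lorentzian.volumeRadius D.h r := rfl

/-- **The printed formula for `3`-dimensional data** (KRS 2015, Def. 2.1):
`r_vol(Σ, r) = inf_x inf_{0 < r' ≤ r} |B_{r'}(x)|_h / r'³`.
[cite: KlainermanRodnianskiSzeftel2015, Def. 2.1] -/
theorem volumeRadius_eq {X : Type*} [TopologicalSpace X]
    [ChartedSpace (EuclideanSpace ℝ (Fin 3)) X] [IsManifold (𝓡 3) ∞ X] [T3Space X]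
    [MeasurableSpace X] [BorelSpace X] (D : InitialDataSet (𝓡 3) X) (r : ℝ) :
    D.volumeRadius r = ⨅ x, ⨅ r' ∈ Ioc 0 r,
      riemannianMeasure D.h (geodesicBall D.h x (ENNReal.ofReal r')) /
        ENNReal.ofReal (r' ^ 3) := by
  simp only [Literature.Geometry.Lorentzian.volumeRadius_eq, finrank_euclideanSpace_fin]

/-- The volume radius of an initial data set is antitone in the scale. [folklore] -/
theorem volumeRadius_anti (D : InitialDataSet I X) : Antitone D.volumeRadius :=
  Literature.Geometry.Lorentzian.volumeRadius_anti D.h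

/-- **Non-collapsing form for `3`-dimensional data**: `c ≤ r_vol(Σ, r)` gives
`c · r'³ ≤ |B_{r'}(x)|_h` for all `x` and `0 < r' ≤ r`.
[cite: KlainermanRodnianskiSzeftel2015, Def. 2.1] -/
theorem mul_le_measure_geodesicBall {X : Type*} [TopologicalSpace X]
    [ChartedSpace (EuclideanSpace ℝ (Fin 3)) X] [IsManifold (𝓡 3) ∞ X] [T3Space X]
    [MeasurableSpace X] [BorelSpace X] (D : InitialDataSet (𝓡 3) X) {c : ℝ≥0∞} {r : ℝ}
    (hc : c ≤ D.volumeRadius r) (x : X) {r' : ℝ} (hr' : 0 < r') (hr'r : r' ≤ r) :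
    c * ENNReal.ofReal (r' ^ 3) ≤
      riemannianMeasure D.h (geodesicBall D.h x (ENNReal.ofReal r')) := by
  simpa only [finrank_euclideanSpace_fin] using
    mul_le_measure_geodesicBall_of_le_volumeRadius D.h hc x hr' hr'r

end InitialDataSet

end Literature.Geometry.Lorentzian

end
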